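import Summits.CriticalPhenomena.PercolationContinuityZ3.Theorems.PercNearOneGluingNoHeavyQuantCorridorAdditive
import HarnessLib

/-!
# QUANT lane, ERP: Kozma–Nitzan's Lemma 11 (elongated-box hittability) with ADDITIVE losses and BOUNDED route scales

builds on p205010 (kernel theorem, internal audit signed; external expert review pending)

Cell `prim-quant` (post-continuity programme, LANE 1, EXPLICIT-RATE PROGRAMME = LADDER R5), seat `prim-quant-p1` (bounded companion of
`prim-quant-p2`'s `…QuantLevelChain.lean`, whose `levelChain_linear` / `elongHit_linear` take the UNBOUNDED linear family
`∀ δ', TargetPropertyAt d p (δ' + η) δ' (qfList d) R₀`, i.e. quarter-face hittability at ALL scales `ℓ ≥ ℓmax` — a hypothesis that cannot be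
verified at `p = p_c`).  Here every step consumes the additive target lemma in the BOUNDED conclusion shape of `Quant.targetLemma_additive_core`
(route scales `ℓ ∈ [R₀, ℓhi]`), exactly as in `…QuantCorridorAdditive.lean` (S3b); the route scales of Lemma 11's targets are bounded by the
width `3s ≤ 3r/8` of the step region (`two_mul_scale_le_of_qfList_Qset_subset`), so `ℓhi ≥ r` suffices.  `--supports stmt-CriticalPhenomena-4575
--as helper`.  No definitions, no sorries; standard axioms.

* `Quant.levelStep_bdd` — one step of Lemma 11 in `Ω`: `P_Ω(0 ↔ face(L,w)) − η ≤ P_Ω(0 ↔ face(L+s, w+R))` (needs `3s ≤ 2ℓhi`);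
* `Quant.levelChain_bdd` — `N` steps: `P_Ω(0 ↔ face(L,w)) − N·η ≤ P_Ω(0 ↔ face(L+Ns, w+NR))`;
* `Quant.elongHit_bdd` — **Lemma 11, additive, bounded**: if the bounded additive target lemma holds for the quarter faces (radius `R₀`, scales
  `≤ ℓhi`, loss `η`) and `Λ_k` is joined inside `Λ_n` to every face orthant of `Λ_n` with probability `> 1 − δ'` for every `n ∈ [n₁, r]`, then
  for `r ≥ 8(3K + 3KR₀ + k + n₁ + 8)`, `r ≤ ℓhi`, `m ≥ k`: the aspect-`K` box at scale `r` is crossed from `Λ_m` to its far face with probability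
  `> 1 − (δ' + (8K−4)·η)` — the hittability hypothesis (a) of `targetLemma_additive_core` / `corridor_effective` for `H = elongList d K` AT SCALE `r`;
* `Quant.elongHit_effective` — the loss discharged by `targetLemma_additive_core` (`η = 6δ`): elongated hittability at scale `r` from quarter-face
  hits at scales `ℓ ∈ [ℓmax, ℓhi]`, orthant-face linking at `(m', M)` and on `[n₁, r]`, the uniqueness zone at `(m', M)`, seeds and radius — all
  finite-volume hypotheses at parameter `p` on BOUNDED scale ranges (with `S4-sqrt`, all of crossing type except `uniqZone`).
[cite: KozmaNitzan2024, §4 Lemma 11 (pp. 22–23), Lemma 10 (p. 17)]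
-/

noncomputable section

namespace Summit.CriticalPhenomena.PercolationContinuityZ3.Theorems.Quant

open MeasureTheory Literature.Probability.LatticeModels Literature.Probability.Percolation
  Literature.Probability.Percolation.KozmaNitzan

variable {d : ℕ}

/-- For a quarter-face route inside the step region `{L − 2s ≤ σ x_a ≤ L + s, |x_j| ≤ r}` of Lemma 11, the scale satisfies `2ℓ ≤ 3s`.
[cite: KozmaNitzan2024, §4 p. 22 (D)] -/
theorem two_mul_scale_le_of_qfList_Qset_subset_region (E : EData d) {g : Geom d} (hg : g ∈ qfList d) {ℓ : ℕ} {v : Site d}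
    {L s : ℤ} (h : g.Qset ℓ v ⊆ E.region L s) : 2 * (ℓ : ℤ) ≤ 3 * s := by
  have h2 := two_mul_scale_le_of_qfList_Qset_subset hg (lo := sLo E.a E.σ 0 (L - 2 * s) (L + s) E.r)
    (hi := sHi E.a E.σ 0 (L - 2 * s) (L + s) E.r) h E.a
  have hwidth : sHi E.a E.σ 0 (L - 2 * s) (L + s) E.r E.a - sLo E.a E.σ 0 (L - 2 * s) (L + s) E.r E.a = 3 * s := by
    simp only [sLo, sHi, if_true, Pi.zero_apply]
    rcases E.hσ with h1 | h1
    · rw [if_pos h1, if_pos h1]; ring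
    · rw [if_neg (by rw [h1]; norm_num), if_neg (by rw [h1]; norm_num)]; ring
  linarith

/-! ## The level chain, additive and bounded -/

/-- **One step of Lemma 11, ADDITIVE with bounded route scales** (KN pp. 22–23; tree `EData.levelStep_of_target`, p2's `levelStep_linear`):
for an admissible step (`EData.StepOK E R₀ R L s w`) with `3s ≤ 2ℓhi`, if the additive target lemma holds for the quarter faces with radius `R₀`,
route scales `≤ ℓhi` and loss `η`, then `P_Ω(0 ↔ face(L, w)) − η ≤ P_Ω(0 ↔ face(L+s, w+R))`. [cite: KozmaNitzan2024, §4 pp. 22–23] -/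
theorem levelStep_bdd [NeZero d] (p : unitInterval) {η : ℝ} {R₀ ℓhi : ℕ}
    (hT : ∀ (W : Sym2 (Site d) → unitInterval) (Sfin D : Finset (Site d)) (lo hi : Site d) (T : Finset (Site d)) (o : Site d),
      FinSupp W Sfin → IsSubbox W p D → D ⊆ Sfin → o ∈ Sfin → o ∉ D →
      Finset.Icc (lo - (R₀ : Site d)) (hi + (R₀ : Site d)) ⊆ D →
      (∀ v ∈ Finset.Icc (lo - (R₀ : Site d)) (hi + (R₀ : Site d)), ∃ ℓ : ℕ, R₀ ≤ ℓ ∧ ℓ ≤ ℓhi ∧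
        ∃ g ∈ qfList d, g.Qset ℓ v ⊆ D ∧ g.Fset ℓ v ⊆ T) →
      T ⊆ D → T.Nonempty →
      (prodBernoulli W).real (⋃ b ∈ Finset.Icc lo hi, openConn o b) - η ≤ (prodBernoulli W).real (⋃ t ∈ T, openConn o t))
    (E : EData d) (R : ℕ) (L s w : ℤ) (hok : EData.StepOK E R₀ R L s w) (hs : 3 * s ≤ 2 * (ℓhi : ℤ)) :
    (prodBernoulli (E.W p)).real (⋃ b ∈ E.face L w, openConn (0 : Site d) b) - η ≤
      (prodBernoulli (E.W p)).real (⋃ b ∈ E.face (L + s) (w + R), openConn (0 : Site d) b) := by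
  have htgt := EData.isTarget_step hok
  exact hT (E.W p) E.bigBox (E.region L s) (sLo E.a E.σ 0 L L w) (sHi E.a E.σ 0 L L w)
    (E.face (L + s) (w + R)) 0 (E.finSupp_W p hok.hkr hok.hK1) (EData.isSubbox_region hok p)
    (EData.region_subset_bigBox hok) E.zero_mem_bigBox (EData.zero_not_mem_region hok)
    (EData.enlarge_face_subset_region hok) (fun v hv => by
      obtain ⟨ℓ, hℓ, g, hg, hQ, hF⟩ := htgt.hit v hv
      refine ⟨ℓ, hℓ, ?_, g, hg, hQ, hF⟩
      have h2 := two_mul_scale_le_of_qfList_Qset_subset_region E hg hQ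
      have : (ℓ : ℤ) ≤ ℓhi := by linarith
      exact_mod_cast this)
    (EData.face_subset_region hok) (EData.face_nonempty hok)

/-- **The chain of Lemma 11, ADDITIVE with bounded route scales**: `N` admissible steps (`EData.ChainOK E R₀ R N L s w`, `3s ≤ 2ℓhi`) give
`P_Ω(0 ↔ face(L, w)) − N·η ≤ P_Ω(0 ↔ face(L + Ns, w + NR))` — the losses ADD. [cite: KozmaNitzan2024, §4 p. 23] -/
theorem levelChain_bdd [NeZero d] (p : unitInterval) {η : ℝ} {R₀ ℓhi : ℕ}
    (hT : ∀ (W : Sym2 (Site d) → unitInterval) (Sfin D : Finset (Site d)) (lo hi : Site d) (T : Finset (Site d)) (o : Site d),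
      FinSupp W Sfin → IsSubbox W p D → D ⊆ Sfin → o ∈ Sfin → o ∉ D →
      Finset.Icc (lo - (R₀ : Site d)) (hi + (R₀ : Site d)) ⊆ D →
      (∀ v ∈ Finset.Icc (lo - (R₀ : Site d)) (hi + (R₀ : Site d)), ∃ ℓ : ℕ, R₀ ≤ ℓ ∧ ℓ ≤ ℓhi ∧
        ∃ g ∈ qfList d, g.Qset ℓ v ⊆ D ∧ g.Fset ℓ v ⊆ T) →
      T ⊆ D → T.Nonempty →
      (prodBernoulli W).real (⋃ b ∈ Finset.Icc lo hi, openConn o b) - η ≤ (prodBernoulli W).real (⋃ t ∈ T, openConn o t))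
    (N : ℕ) :
    ∀ (E : EData d) (R : ℕ) (L s w : ℤ), EData.ChainOK E R₀ R N L s w → 3 * s ≤ 2 * (ℓhi : ℤ) →
      (prodBernoulli (E.W p)).real (⋃ b ∈ E.face L w, openConn (0 : Site d) b) - N * η ≤
        (prodBernoulli (E.W p)).real (⋃ b ∈ E.face (L + N * s) (w + N * R), openConn (0 : Site d) b) := by
  induction N with
  | zero =>
    intro E R L s w _ _
    simp
  | succ N ih =>
    intro E R L s w hok hs
    have step := levelStep_bdd p hT E R L s w (hok.stepOK hok.hR) hs
    have rest := ih E R (L + s) s (w + R) hok.shift hs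
    have e1 : L + s + (N : ℤ) * s = L + ((N + 1 : ℕ) : ℤ) * s := by push_cast; ring
    have e2 : w + (R : ℤ) + (N : ℤ) * R = w + ((N + 1 : ℕ) : ℤ) * R := by push_cast; ring
    rw [e1, e2] at rest
    have e3 : ((N + 1 : ℕ) : ℝ) * η = η + (N : ℝ) * η := by push_cast; ring
    rw [e3]
    linarith

/-! ## Lemma 11, additive and bounded -/

/-- **Kozma–Nitzan's Lemma 11 with ADDITIVE loss and BOUNDED scale ranges.**  Data: direction `a`, sign `σ`, aspect `K ≥ 2`; the bounded additive
target lemma for the quarter faces (radius `R₀`, route scales `≤ ℓhi`, loss `η`); a seed radius `k`, a threshold `n₁`.  If `Λ_k` is joined inside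
`Λ_n` to every face orthant of `Λ_n` with probability `> 1 − δ'` for every `n ∈ [n₁, r]`, then for every `r ≥ 8(3K + 3KR₀ + k + n₁ + 8)` with
`r ≤ ℓhi` and every `m ≥ k`, the elongated box `{-r ≤ σx_a ≤ Kr, |x_j| ≤ r}` is crossed from `Λ_m` to its far face `{σ x_a = Kr}` inside the box
with probability `> 1 − (δ' + (8K−4)·η)`.  Proof = the tree's `isHittable_elongGeom_of_target` / p2's `elongHit_linear` with `levelChain_bdd`
(`8K − 4` steps of width `s = ⌊r/8⌋`, so route scales `≤ 3s/2 ≤ r ≤ ℓhi`). [cite: KozmaNitzan2024, §4 Lemma 11 (pp. 22–23)] -/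
theorem elongHit_bdd [NeZero d] (p : unitInterval) {η : ℝ} {R₀ ℓhi : ℕ}
    (hT : ∀ (W : Sym2 (Site d) → unitInterval) (Sfin D : Finset (Site d)) (lo hi : Site d) (T : Finset (Site d)) (o : Site d),
      FinSupp W Sfin → IsSubbox W p D → D ⊆ Sfin → o ∈ Sfin → o ∉ D →
      Finset.Icc (lo - (R₀ : Site d)) (hi + (R₀ : Site d)) ⊆ D →
      (∀ v ∈ Finset.Icc (lo - (R₀ : Site d)) (hi + (R₀ : Site d)), ∃ ℓ : ℕ, R₀ ≤ ℓ ∧ ℓ ≤ ℓhi ∧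
        ∃ g ∈ qfList d, g.Qset ℓ v ⊆ D ∧ g.Fset ℓ v ⊆ T) →
      T ⊆ D → T.Nonempty →
      (prodBernoulli W).real (⋃ b ∈ Finset.Icc lo hi, openConn o b) - η ≤ (prodBernoulli W).real (⋃ t ∈ T, openConn o t))
    (a : Fin d) (σ : ℤˣ) (K : ℕ) (hK : 2 ≤ K) {k n₁ r m : ℕ} {δ' : ℝ}
    (hlink : ∀ n : ℕ, n₁ ≤ n → n ≤ r → ∀ (a' : Fin d) (τ : Fin d → ℤˣ),
      1 - δ' < (bondPercolation (zdGraph d) p).real (linkEvent (box d k) (orthantFace a' τ n) n))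
    (hr : 8 * (3 * K + 3 * K * R₀ + k + n₁ + 8) ≤ r) (hℓhi : r ≤ ℓhi) (hm : k ≤ m) :
    1 - (δ' + (8 * K - 4 : ℕ) * η) < (bondPercolation (zdGraph d) p).real
      (linkIn (↑((elongGeom a σ K (by omega)).Qset r 0)) (box d m) ((elongGeom a σ K (by omega)).Fset r 0)) := by
  have hK1 : 1 ≤ K := by omega
  set N : ℕ := 8 * K - 4 with hNdef
  have hN : (N : ℤ) = 8 * K - 4 := by rw [hNdef]; omega
  set A : ℕ := 3 * K + 3 * K * R₀ + k + n₁ + 8 with hAdef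
  rw [elongGeom_Qset a σ K hK1 k r, elongGeom_Fset a σ K hK1 k r]
  -- the parameters of the chain
  set s : ℕ := r / 8 with hsdef
  have hs1 : 8 * s ≤ r := Nat.mul_div_le r 8
  have hs2 : r < 8 * s + 8 := by
    have := Nat.div_add_mod r 8; have := Nat.mod_lt r (show 0 < 8 by norm_num); omega
  have hAs : A ≤ s := by
    rw [hsdef]; exact (Nat.le_div_iff_mul_le (by norm_num)).2 (by linarith)
  set E : EData d := elongData a σ K r k with hE
  set L₀ : ℤ := K * r - N * s with hL₀
  -- casts
  have hK' : (2 : ℤ) ≤ K := by exact_mod_cast hK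
  have hs1' : 8 * (s : ℤ) ≤ r := by exact_mod_cast hs1
  have hs2' : (r : ℤ) < 8 * s + 8 := by exact_mod_cast hs2
  have hAs' : (A : ℤ) ≤ s := by exact_mod_cast hAs
  have hA' : (A : ℤ) = 3 * K + 3 * K * R₀ + k + n₁ + 8 := by rw [hAdef]; push_cast; ring
  have hKr1 : (K : ℤ) * (8 * s) ≤ K * r := mul_le_mul_of_nonneg_left hs1' (by positivity)
  have hKr2 : (K : ℤ) * r ≤ K * (8 * s + 8) := mul_le_mul_of_nonneg_left hs2'.le (by positivity)
  have hKR0 : (0 : ℤ) ≤ K * R₀ := by positivity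
  have hNs : (N : ℤ) * s = 8 * (K * s) - 4 * s := by rw [hN]; ring
  have hNR : (N : ℤ) * R₀ = 8 * (K * R₀) - 4 * R₀ := by rw [hN]; ring
  have hKR : (R₀ : ℤ) ≤ K * R₀ := by
    have : (1 : ℤ) * R₀ ≤ K * R₀ := mul_le_mul_of_nonneg_right (by linarith) (by positivity)
    linarith
  have hrK : (r : ℤ) ≤ K * r := by
    have : (1 : ℤ) * r ≤ K * r := mul_le_mul_of_nonneg_right (by linarith) (by positivity)
    linarith
  have hL₀lo : 4 * (s : ℤ) ≤ L₀ := by rw [hL₀]; linarith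
  have hL₀hi : L₀ ≤ 4 * (s : ℤ) + 8 * K := by rw [hL₀]; linarith
  have hL₀r : L₀ ≤ r := by linarith
  -- the bounded-scale condition of the steps: `3s ≤ 2ℓhi`
  have hsℓ : 3 * (s : ℤ) ≤ 2 * (ℓhi : ℤ) := by
    have : (r : ℤ) ≤ ℓhi := by exact_mod_cast hℓhi
    linarith
  -- the chain conditions
  have hok : EData.ChainOK E R₀ R₀ N L₀ s L₀ :=
    { hR := le_rfl
      hs := by linarith
      hw := by linarith
      hr := by
        show L₀ + (N : ℤ) * R₀ + s + 2 * R₀ ≤ (r : ℤ)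
        linarith
      hk := by
        show ((k : ℕ) : ℤ) < L₀ - 2 * s
        linarith
      hK := by
        show L₀ + (N : ℤ) * s ≤ (K : ℤ) * r
        rw [hL₀]; linarith
      hkr := by
        show k ≤ r
        have : (k : ℤ) ≤ r := by linarith
        exact_mod_cast this
      hK1 := by show 1 ≤ K; omega }
  -- the initial face: a full face of the cube `Λ_{L₀}` is reached from `Λ_k` (hypothesis `hlink`)
  have hL₀0 : 0 ≤ L₀ := by linarith
  set L₀' : ℕ := L₀.toNat with hL₀'
  have hL₀cast : (L₀' : ℤ) = L₀ := Int.toNat_of_nonneg hL₀0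
  have hn₁ : n₁ ≤ L₀' := by
    have : (n₁ : ℤ) ≤ L₀' := by rw [hL₀cast]; linarith
    exact_mod_cast this
  have hL₀'r : L₀' ≤ r := by
    have : (L₀' : ℤ) ≤ r := by rw [hL₀cast]; exact hL₀r
    exact_mod_cast this
  set τ₀ : Fin d → ℤˣ := fun _ => σ with hτ₀
  have hinit : 1 - δ' < (prodBernoulli (E.W p)).real (⋃ b ∈ E.face L₀ L₀, openConn (0 : Site d) b) := by
    rw [E.real_W_biUnion_openConn p hok.hkr hok.hK1]
    refine (hlink L₀' hn₁ hL₀'r a τ₀).trans_le (measureReal_mono ?_ (measure_ne_top _ _))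
    rintro ω ⟨y, hy, x, hx, hω⟩
    simp only [Set.mem_iUnion, exists_prop, Finset.mem_coe]
    refine ⟨x, ?_, y, hy, ?_⟩
    · -- the face orthant lies on the full face
      rw [mem_orthantFace, mem_box] at hx
      obtain ⟨hxb, hxa, -⟩ := hx
      rw [EData.mem_face_iff]
      refine ⟨?_, fun j _ => ?_⟩
      · change (σ : ℤ) * x a = L₀
        rw [← hL₀cast, ← hxa]
      · have := hxb j; rw [hL₀cast] at this; exact this
    · -- `Λ_{L₀} ⊆` the elongated box
      rw [DCT16.mem_openConnIn_iff_pathIn] at hω ⊢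
      refine hω.mono fun z hz => ?_
      rw [Finset.mem_coe, mem_box] at hz
      rw [Finset.mem_coe, EData.mem_bigBox_iff]
      have hza := level_bounds_of_symm E.hσ (hz a).1 (hz a).2
      change (-(r : ℤ) ≤ E.σ * z a ∧ E.σ * z a ≤ K * r) ∧ ∀ j, j ≠ a → -(r : ℤ) ≤ z j ∧ z j ≤ r
      rw [hL₀cast] at hza
      refine ⟨⟨by linarith [hza.1], by linarith [hza.2]⟩, fun j _ => ?_⟩
      have := hz j; rw [hL₀cast] at this
      constructor <;> linarith [this.1, this.2]
  -- the chain (additive)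
  have hend := levelChain_bdd p hT N E R₀ L₀ s L₀ hok hsℓ
  have hlev : L₀ + (N : ℤ) * s = r * K := by rw [hL₀]; ring
  rw [hlev, E.real_W_biUnion_openConn p hok.hkr hok.hK1, E.real_W_biUnion_openConn p hok.hkr hok.hK1] at hend
  rw [E.real_W_biUnion_openConn p hok.hkr hok.hK1] at hinit
  -- back to the geometry
  have hmono : (bondPercolation (zdGraph d) p).real
        (⋃ t ∈ (↑(E.face (r * K) (L₀ + N * R₀)) : Set (Site d)), ⋃ s ∈ (↑E.cube : Set (Site d)),
          openConnIn (↑E.bigBox : Set (Site d)) s t) ≤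
      (bondPercolation (zdGraph d) p).real (linkIn (↑(elongData a σ K r k).bigBox) (box d m) ((elongData a σ K r k).face (r * K) r)) := by
    refine measureReal_mono ?_ (measure_ne_top _ _)
    intro ω hω
    simp only [Set.mem_iUnion, exists_prop, Finset.mem_coe] at hω
    obtain ⟨t, ht, y, hy, hω⟩ := hω
    refine ⟨y, box_mono d hm hy, t, ?_, hω⟩
    rw [EData.mem_face_iff] at ht ⊢
    refine ⟨ht.1, fun j hj => ?_⟩
    have h2 := ht.2 j hj
    have hwid : L₀ + (N : ℤ) * R₀ ≤ r := by
      have h1 : L₀ + (N : ℤ) * R₀ + s + 2 * R₀ ≤ (r : ℤ) := hok.hr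
      have h2' : (0 : ℤ) ≤ s := by positivity
      have h3 : (0 : ℤ) ≤ R₀ := by positivity
      linarith
    change -(r : ℤ) ≤ t j ∧ t j ≤ r
    constructor <;> linarith [h2.1, h2.2]
  have hN' : ((8 * K - 4 : ℕ) : ℝ) = (N : ℝ) := by rw [hNdef]
  rw [hN']
  linarith [hinit, hend, hmono]

/-- **Lemma 11 EFFECTIVE (bounded)**: the loss of `elongHit_bdd` discharged by `Quant.targetLemma_additive_core` (`η = 6δ`).  Hypotheses, all
finite-volume at parameter `p` (`0 ≤ p < 1`) and on BOUNDED scale ranges: (a) every quarter-face geometry is hit from `Λ_{m'}` inside `ℓQ` with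
probability `> 1 − δ²` for `ℓ ∈ [ℓmax, ℓhi]`; (b) orthant-face linking at `(m', M)` with probability `> 1 − δ²`; (c) `P_p(uniqZone m' M) > 1 − δ²`;
(d) `(1 − p^{seedBound d M})^k' ≤ δ`; (e) `R₀ ≥ 3M + ℓmax + 4 + ⌈(1−p)^{−2d·Ncont d M k'}/δ⌉`; and (f) orthant-face linking from `Λ_k` at every
`n ∈ [n₁, r]` with probability `> 1 − δ'`.  Conclusion: for `r ≥ 8(3K + 3KR₀ + k + n₁ + 8)`, `r ≤ ℓhi`, `m ≥ k`, the aspect-`K` box at scale `r` is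
crossed from `Λ_m` with probability `> 1 − (δ' + (8K−4)·6δ)`.  With the lead's `S4-sqrt` (`real_linkIn_qfGeom_gt_of_boxCrossing`,
`real_linkEvent_orthantFace_gt_of_boxCrossing`) the inputs (a), (b), (f) are box-crossing probabilities on bounded windows.
[cite: KozmaNitzan2024, §4 Lemma 11 (pp. 22–23), Lemma 10 (pp. 17–22)] -/
theorem elongHit_effective [NeZero d] (p : unitInterval) (hp1 : (p : ℝ) < 1)
    {δ : ℝ} (hδ : 0 < δ) {m' M ℓmax ℓhi k' R₀ : ℕ} (hmM : m' < M)
    (hhitq : ∀ g ∈ qfList d, ∀ ℓ : ℕ, ℓmax ≤ ℓ → ℓ ≤ ℓhi →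
      1 - δ ^ 2 < (bondPercolation (zdGraph d) p).real (linkIn (↑(g.Qset ℓ 0)) (box d m') (g.Fset ℓ 0)))
    (hface : ∀ (a : Fin d) (τ : Fin d → ℤˣ),
      1 - δ ^ 2 < (bondPercolation (zdGraph d) p).real (linkEvent (box d m') (orthantFace a τ M) M))
    (huniq : 1 - δ ^ 2 < (bondPercolation (zdGraph d) p).real (uniqZone m' M))
    (hk : (1 - (p : ℝ) ^ seedBound d M) ^ k' ≤ δ)
    (hR : 3 * M + ℓmax + 4 + ⌈(1 / (1 - (p : ℝ)) ^ (2 * d * LData.Ncont d M k')) / δ⌉₊ ≤ R₀)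
    (a : Fin d) (σ : ℤˣ) (K : ℕ) (hK : 2 ≤ K) {k n₁ r m : ℕ} {δ' : ℝ}
    (hlink : ∀ n : ℕ, n₁ ≤ n → n ≤ r → ∀ (a' : Fin d) (τ : Fin d → ℤˣ),
      1 - δ' < (bondPercolation (zdGraph d) p).real (linkEvent (box d k) (orthantFace a' τ n) n))
    (hr : 8 * (3 * K + 3 * K * R₀ + k + n₁ + 8) ≤ r) (hℓhi : r ≤ ℓhi) (hm : k ≤ m) :
    1 - (δ' + (8 * K - 4 : ℕ) * (6 * δ)) < (bondPercolation (zdGraph d) p).real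
      (linkIn (↑((elongGeom a σ K (by omega)).Qset r 0)) (box d m) ((elongGeom a σ K (by omega)).Fset r 0)) := by
  have hq := targetLemma_additive_core p hp1 hδ (qfList d) hmM hhitq hface huniq hk hR
  exact elongHit_bdd p (η := 6 * δ) (R₀ := R₀) (ℓhi := ℓhi)
    (fun W Sfin D lo hi T o hfin hsub hDS ho hoD hBR htgt hTD hTne =>
      hq W Sfin D lo hi T o hfin hsub hDS ho hoD hBR htgt hTD hTne)
    a σ K hK hlink hr hℓhi hm

end Summit.CriticalPhenomena.PercolationContinuityZ3.Theorems.Quant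

end
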